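import Mathlib
import Summits.ValiantsHypothesis.ValiantsHypothesis.Theorems.LacunarySymmetroidMatrixDescartesCensusRealExponentsThreeByThree
import Summits.ValiantsHypothesis.ValiantsHypothesis.Theorems.LacunarySymmetroidMatrixDescartesCensusConfluentClosureChain

/-!
# `MatrixDescartes` census — confluent closure, GENERAL FORMAT: every `m ∈ {2,3}` register `PosRootLawAt m K B`

HONEST FRAMING.  Object-search cell `pub-symmetroid`; the census registers `ζ_sym(2,K)`, `ζ_sym(3,K)` are the statements
`PosRootLawAt m K B` (door A = `PosRootLawAt 2 6 19`, stmt-ValiantsHypothesis-19979; its `(3,4)` companion = `PosRootLawAt 3 4 18`,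
stmt-19980; the finite-table rows `η`, `ν` at `(2,7)`, `(2,8)`, …).  This file generalises `…CensusConfluentClosure{,Chain,ThreeFour}`
from the two doors to EVERY number of terms: a CONFLUENT pencil with one log-letter pair and `k` further ordinary letters,
`F₀(t) = S₀ + e^{a t}(A + t·B) + ∑_{l<k} e^{δ_l t} S_l` (so `K = k + 3` terms after un-confluence), whose determinant alternates
strictly in sign along a chain of `B + 2` abscissae, refutes `PosRootLawAt m (k+3) B` for `m = 2` and `m = 3`.  Nothing is
decided; no such pencil is claimed; no register moves; nothing on `MatrixDescartes` (stmt-18050) or `VP ≠ VNP`.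

* `approx_sum_eq_general` — the honest `(k+3)`-term pencils on exponents `(0, a, a+η, δ)` with letters `(S₀, A − η⁻¹B, η⁻¹B, S)`;
* `tendsto_det_approx_general` — pointwise convergence of their determinants (any size `m`);
* `not_posRootLawAt_two_of_confluent_chain`, `not_posRootLawAt_three_of_confluent_chain`.

[folklore] Elementary (difference quotient, continuity of `det`, IVT on consecutive gaps, the tree's real-exponent transfer).
-/

-- `Summit.ValiantsHypothesis.ValiantsHypothesis.…` repeats a component by the D-0017 layout
-- (single-conjunct summit), which the `dupNamespace` linter flags; the name is mandated.
set_option linter.dupNamespace false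

namespace Summit.ValiantsHypothesis.ValiantsHypothesis.Theorems.LacunarySymmetroidMatrixDescartes.Census.RealExp.Confluent

open Filter Topology
open scoped BigOperators Matrix
open Summit.ValiantsHypothesis.ValiantsHypothesis.Theorems.MatrixDescartes.Negative (PosRootLawAt)
open Summit.ValiantsHypothesis.ValiantsHypothesis.Theorems.LacunarySymmetroidMatrixDescartes.Census.RealExp
  (ncard_rpow_eq_ncard_exp not_posRootLawAt_two_iff not_posRootLawAt_three_iff)

/-- **Honest approximants, general format**: for `η ≠ 0` the `(k+3)`-term real-exponent pencil on exponents
`Fin.cons 0 (Fin.cons a (Fin.cons (a+η) δ))` with letters `Fin.cons S₀ (Fin.cons (A − η⁻¹B) (Fin.cons (η⁻¹B) S))` equals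
`S₀ + e^{a t}(A + ((e^{η t} − 1)/η)·B) + ∑_l e^{δ_l t} S_l`. [folklore] -/
theorem approx_sum_eq_general {m k : ℕ} (a : ℝ) (δ : Fin k → ℝ) (S₀ A B : Matrix (Fin m) (Fin m) ℝ)
    (S : Fin k → Matrix (Fin m) (Fin m) ℝ) {η : ℝ} (hη : η ≠ 0) (t : ℝ) :
    ∑ l, Real.exp ((Fin.cons 0 (Fin.cons a (Fin.cons (a + η) δ)) : Fin (k + 3) → ℝ) l * t) •
        (Fin.cons S₀ (Fin.cons (A - η⁻¹ • B) (Fin.cons (η⁻¹ • B) S)) : Fin (k + 3) → Matrix (Fin m) (Fin m) ℝ) l =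
      S₀ + Real.exp (a * t) • (A + ((Real.exp (η * t) - 1) / η) • B) + ∑ l, Real.exp (δ l * t) • S l := by
  rw [Fin.sum_univ_succ, Fin.sum_univ_succ, Fin.sum_univ_succ]
  simp only [Fin.cons_zero, Fin.cons_succ]
  ext i j
  simp only [Matrix.add_apply, Matrix.smul_apply, Matrix.sub_apply, smul_eq_mul, zero_mul, Real.exp_zero, one_mul,
    add_mul, Real.exp_add]
  field_simp
  ring

/-- **Pointwise convergence of the general approximants' determinants** to `det F₀(t)` as `η → 0⁺`. [folklore] -/
theorem tendsto_det_approx_general {m k : ℕ} (a : ℝ) (δ : Fin k → ℝ) (S₀ A B : Matrix (Fin m) (Fin m) ℝ)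
    (S : Fin k → Matrix (Fin m) (Fin m) ℝ) (t : ℝ) :
    Tendsto (fun η : ℝ => (∑ l, Real.exp ((Fin.cons 0 (Fin.cons a (Fin.cons (a + η) δ)) : Fin (k + 3) → ℝ) l * t) •
        (Fin.cons S₀ (Fin.cons (A - η⁻¹ • B) (Fin.cons (η⁻¹ • B) S)) : Fin (k + 3) → Matrix (Fin m) (Fin m) ℝ) l).det)
      (𝓝[>] 0) (𝓝 (S₀ + Real.exp (a * t) • (A + t • B) + ∑ l, Real.exp (δ l * t) • S l).det) := by
  have hM : Tendsto (fun η : ℝ => S₀ + Real.exp (a * t) • (A + ((Real.exp (η * t) - 1) / η) • B) +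
        ∑ l, Real.exp (δ l * t) • S l) (𝓝[>] 0) (𝓝 (S₀ + Real.exp (a * t) • (A + t • B) + ∑ l, Real.exp (δ l * t) • S l)) := by
    refine (tendsto_const_nhds.add ?_).add tendsto_const_nhds
    exact (tendsto_const_nhds.add ((tendsto_expSlope t).smul_const B)).const_smul _
  have hdet := ((continuous_id.matrix_det).tendsto _).comp hM
  refine hdet.congr' ?_
  filter_upwards [self_mem_nhdsWithin] with η hη
  simp only [Function.comp, id]
  rw [approx_sum_eq_general a δ S₀ A B S (ne_of_gt hη) t]

/-- The general approximants' letters are symmetric when the data are. [folklore] -/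
theorem approxLetters_isSymm_general {m k : ℕ} {S₀ A B : Matrix (Fin m) (Fin m) ℝ} {S : Fin k → Matrix (Fin m) (Fin m) ℝ}
    (h₀ : S₀.IsSymm) (hA : A.IsSymm) (hB : B.IsSymm) (hS : ∀ l, (S l).IsSymm) (η : ℝ) (l : Fin (k + 3)) :
    ((Fin.cons S₀ (Fin.cons (A - η⁻¹ • B) (Fin.cons (η⁻¹ • B) S)) : Fin (k + 3) → Matrix (Fin m) (Fin m) ℝ) l).IsSymm := by
  refine Fin.cases ?_ (fun l₁ => ?_) l
  · simp only [Fin.cons_zero]; exact h₀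
  · refine Fin.cases ?_ (fun l₂ => ?_) l₁
    · simp only [Fin.cons_succ, Fin.cons_zero]; exact hA.sub (hB.smul _)
    · refine Fin.cases ?_ (fun l₃ => ?_) l₂
      · simp only [Fin.cons_succ, Fin.cons_zero]; exact hB.smul _
      · simp only [Fin.cons_succ]; exact hS l₃

/-- Eventually (η → 0⁺) the general approximant inherits every strict alternation of the confluent determinant along a
finite chain. [folklore] -/
theorem eventually_chain_general {m k n : ℕ} (a : ℝ) (δ : Fin k → ℝ) (S₀ A B : Matrix (Fin m) (Fin m) ℝ)
    (S : Fin k → Matrix (Fin m) (Fin m) ℝ) (p : Fin (n + 1) → ℝ)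
    (hsign : ∀ i : Fin n,
      (S₀ + Real.exp (a * p i.castSucc) • (A + p i.castSucc • B) + ∑ l, Real.exp (δ l * p i.castSucc) • S l).det *
        (S₀ + Real.exp (a * p i.succ) • (A + p i.succ • B) + ∑ l, Real.exp (δ l * p i.succ) • S l).det < 0) :
    ∃ η : ℝ, 0 < η ∧ ∀ i : Fin n,
      (∑ l, Real.exp ((Fin.cons 0 (Fin.cons a (Fin.cons (a + η) δ)) : Fin (k + 3) → ℝ) l * p i.castSucc) •
          (Fin.cons S₀ (Fin.cons (A - η⁻¹ • B) (Fin.cons (η⁻¹ • B) S)) : Fin (k + 3) → Matrix (Fin m) (Fin m) ℝ) l).det *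
        (∑ l, Real.exp ((Fin.cons 0 (Fin.cons a (Fin.cons (a + η) δ)) : Fin (k + 3) → ℝ) l * p i.succ) •
          (Fin.cons S₀ (Fin.cons (A - η⁻¹ • B) (Fin.cons (η⁻¹ • B) S)) : Fin (k + 3) → Matrix (Fin m) (Fin m) ℝ) l).det
          < 0 := by
  have hall : ∀ᶠ η in 𝓝[>] (0 : ℝ), ∀ i : Fin n,
      (∑ l, Real.exp ((Fin.cons 0 (Fin.cons a (Fin.cons (a + η) δ)) : Fin (k + 3) → ℝ) l * p i.castSucc) •
          (Fin.cons S₀ (Fin.cons (A - η⁻¹ • B) (Fin.cons (η⁻¹ • B) S)) : Fin (k + 3) → Matrix (Fin m) (Fin m) ℝ) l).det *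
        (∑ l, Real.exp ((Fin.cons 0 (Fin.cons a (Fin.cons (a + η) δ)) : Fin (k + 3) → ℝ) l * p i.succ) •
          (Fin.cons S₀ (Fin.cons (A - η⁻¹ • B) (Fin.cons (η⁻¹ • B) S)) : Fin (k + 3) → Matrix (Fin m) (Fin m) ℝ) l).det
          < 0 := by
    refine eventually_all.2 fun i => ?_
    have hprod := (tendsto_det_approx_general a δ S₀ A B S (p i.castSucc)).mul
      (tendsto_det_approx_general a δ S₀ A B S (p i.succ))
    exact hprod.eventually (Iio_mem_nhds (hsign i))
  obtain ⟨η, hη, hηpos⟩ := (hall.and (self_mem_nhdsWithin : ∀ᶠ η in 𝓝[>] (0 : ℝ), η ∈ Set.Ioi (0 : ℝ))).exists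
  exact ⟨η, hηpos, hη⟩

/-- **General confluent closure, `2 × 2`**: symmetric letters and `B + 2` strictly increasing abscissae (in `t = log x`) at which
the determinant of the confluent pencil `S₀ + e^{a t}(A + t·B') + ∑_{l<k} e^{δ_l t} S_l` alternates strictly in sign ⇒
`¬ PosRootLawAt 2 (k+3) B`. [folklore] -/
theorem not_posRootLawAt_two_of_confluent_chain {k B : ℕ} (a : ℝ) (δ : Fin k → ℝ) {S₀ A B' : Matrix (Fin 2) (Fin 2) ℝ}
    {S : Fin k → Matrix (Fin 2) (Fin 2) ℝ} (h₀ : S₀.IsSymm) (hA : A.IsSymm) (hB : B'.IsSymm) (hS : ∀ l, (S l).IsSymm)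
    (p : Fin (B + 2) → ℝ) (hp : StrictMono p)
    (hsign : ∀ i : Fin (B + 1),
      (S₀ + Real.exp (a * p i.castSucc) • (A + p i.castSucc • B') + ∑ l, Real.exp (δ l * p i.castSucc) • S l).det *
        (S₀ + Real.exp (a * p i.succ) • (A + p i.succ • B') + ∑ l, Real.exp (δ l * p i.succ) • S l).det < 0) :
    ¬ PosRootLawAt 2 (k + 3) B := by
  obtain ⟨η, -, hη⟩ := eventually_chain_general a δ S₀ A B' S p hsign
  have hcount := (le_ncard_of_chain _ _ (Nat.succ_pos B) p hp hη).2
  rw [← ncard_rpow_eq_ncard_exp] at hcount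
  exact (not_posRootLawAt_two_iff (k + 3) B).mpr ⟨_, _, approxLetters_isSymm_general h₀ hA hB hS η, hcount⟩

/-- **General confluent closure, `3 × 3`**: the same with `3 × 3` letters ⇒ `¬ PosRootLawAt 3 (k+3) B`. [folklore] -/
theorem not_posRootLawAt_three_of_confluent_chain {k B : ℕ} (a : ℝ) (δ : Fin k → ℝ) {S₀ A B' : Matrix (Fin 3) (Fin 3) ℝ}
    {S : Fin k → Matrix (Fin 3) (Fin 3) ℝ} (h₀ : S₀.IsSymm) (hA : A.IsSymm) (hB : B'.IsSymm) (hS : ∀ l, (S l).IsSymm)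
    (p : Fin (B + 2) → ℝ) (hp : StrictMono p)
    (hsign : ∀ i : Fin (B + 1),
      (S₀ + Real.exp (a * p i.castSucc) • (A + p i.castSucc • B') + ∑ l, Real.exp (δ l * p i.castSucc) • S l).det *
        (S₀ + Real.exp (a * p i.succ) • (A + p i.succ • B') + ∑ l, Real.exp (δ l * p i.succ) • S l).det < 0) :
    ¬ PosRootLawAt 3 (k + 3) B := by
  obtain ⟨η, -, hη⟩ := eventually_chain_general a δ S₀ A B' S p hsign
  have hcount := (le_ncard_of_chain _ _ (Nat.succ_pos B) p hp hη).2
  rw [← ncard_rpow_eq_ncard_exp] at hcount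
  exact (not_posRootLawAt_three_iff (k + 3) B).mpr ⟨_, _, approxLetters_isSymm_general h₀ hA hB hS η, hcount⟩

end Summit.ValiantsHypothesis.ValiantsHypothesis.Theorems.LacunarySymmetroidMatrixDescartes.Census.RealExp.Confluent
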